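import Literature.MathematicalPhysics.QuantumLattice.XYOrderProofs
import HarnessLib

/-!
# Kennedy–Lieb–Shastry, XY model: ground-state Gaussian domination (the input of fact (A))

Trunk T-QLATTICE. Decomposition file for the one remaining named fact of
`XYOrderProofs.lean`, the ground-state infrared bound **(A)** `kls_xy_infraredBound_ground`
(Kennedy–Lieb–Shastry 1988, eq. (4)), along the *direct ground-state route* of Kennedy, Lieb and
Shastry, J. Stat. Phys. 53 (1988) 1019–1030 ("It is possible to prove inequality (1) directly in
the ground state", pp. 1026–1029), indicated for the XY model in [KLS1988PRL] after eq. (4) ("It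
can also be derived directly in the ground state, as done in the XXX context in Ref. 4").

That route has one analytic input, **Gaussian domination for the ground-state energy**
([KLS1988JSP], eq. (18): `E(h) ≥ E(0) ∀ h`), proved there by reflection positivity in the real
coefficient matrix of a real ground state (eqs. (20)–(25)) and a descent on the number of bonds
with `h_x ≠ h_y`. Everything else — second-order perturbation theory (19), the susceptibility
bound (14), the spectral Cauchy–Schwarz inequality (12), the double commutator (13), and the sum
over the two Fourier components — is finite-dimensional linear algebra and is *proved* in the
sibling file `XYOrderInfraredProofs.lean`, which derives (A) from the single named fact below.

## The field-dependent Hamiltonian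

For the ferromagnetic XY model `H = -Σ_{⟨xy⟩} (S¹_x S¹_y + S²_x S²_y)` on the torus `(ℤ/Lℤ)^d`
(`xyTorus`) and a real field `h : Λ → ℝ`, Gaussian domination concerns the Hamiltonian obtained
by the substitution `-S¹_x S¹_y = ½(S¹_x - S¹_y)² - ½(S¹_x)² - ½(S¹_y)² ↦
½(S¹_x - S¹_y - h_x + h_y)² - ½(S¹_x)² - ½(S¹_y)²` on every bond, i.e.
`H(h) = H - Σ_{⟨xy⟩} (h_x - h_y)(S¹_x - S¹_y) + ½ Σ_{⟨xy⟩} (h_x - h_y)²`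
(`xyFieldHamiltonian`; bonds are enumerated as `(x, x + eᵢ)`, which lists every edge of the
torus graph exactly once for `L ≥ 3`). This is the XY analogue of [KLS1988JSP] eq. (17) (there,
for the antiferromagnet after the sublattice rotation (15)–(16), the field is put on the third
component); only the component carrying the field is completed to a square, so that `H(0) = H`
exactly.

## Main definitions and the named fact

* `xyGradField L n h = Σ_x Σᵢ (h_x - h_{x+eᵢ}) (S¹_x - S¹_{x+eᵢ})`, `xyFieldEnergy L h =
  Σ_x Σᵢ (h_x - h_{x+eᵢ})²`, `xyFieldHamiltonian L n h = xyTorus - xyGradField + ½ xyFieldEnergy`.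
* `xyCosMode L n q = Σ_x cos(q·x) S¹_x`, `xySinMode L n q = Σ_x sin(q·x) S¹_x`: the two Hermitian
  Fourier modes at momentum `q` (the fields `h = cos(q·), sin(q·)` of the Gaussian domination
  argument, and `ĝ¹_q = |Λ|⁻¹(ω(C_q²) + ω(D_q²))`).
* `kls_xy_gaussianDomination_ground` **(GD)**: for even sides `L ≥ 4`, all `d`, all spins and
  all real fields `h`, `E₀(xyTorus d L n) ≤ E₀(xyFieldHamiltonian L n h)`.

## References

* [KLS1988JSP] T. Kennedy, E. H. Lieb, B. S. Shastry, *Existence of Néel order in some spin-½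
  Heisenberg antiferromagnets*, J. Stat. Phys. 53 (1988) 1019–1030, eqs. (17)–(25).
* [KLS1988PRL] T. Kennedy, E. H. Lieb, B. S. Shastry, *The XY model has long-range order for all
  spins and all dimensions greater than one*, Phys. Rev. Lett. 61 (1988) 2582–2584, eq. (4) and
  the remarks following it.
* [DLS1978] F. J. Dyson, E. H. Lieb, B. Simon, *Phase transitions in quantum spin systems with
  isotropic and nonisotropic interactions*, J. Stat. Phys. 18 (1978) 335–383 (Gaussian
  domination at positive temperature, of which (GD) is the zero-temperature limit).
-/

noncomputable section

open Matrix Finset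
open Literature.MathematicalPhysics.QuantumLattice Literature.Probability.LatticeModels

namespace Literature.MathematicalPhysics.QuantumLattice

variable {d : ℕ}

/-- The field term `V_h = Σ_x Σᵢ (h_x - h_{x+eᵢ}) (S¹_x - S¹_{x+eᵢ})` (sum over sites and lattice
directions, i.e. over the bonds `(x, x + eᵢ)` of the torus). [Kennedy–Lieb–Shastry, J. Stat.
Phys. 53 (1988), eq. (17) (the cross term of the completed square)] [cite: KLS1988JSP, eq. (17)] -/
def xyGradField (L : ℕ) [NeZero L] (n : ℕ) (h : TorusSite d L → ℝ) : Op (TorusSite d L) (n + 1) :=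
  ∑ x : TorusSite d L, ∑ i : Fin d,
    ((h x - h (x + Pi.single i 1) : ℝ) : ℂ) •
      (siteSpin n x 0 - siteSpin n (x + Pi.single i 1) 0)

/-- The field energy `Q(h) = Σ_x Σᵢ (h_x - h_{x+eᵢ})²` (the constant term of the completed
square; the Dirichlet form of the torus). [Kennedy–Lieb–Shastry, J. Stat. Phys. 53 (1988),
eq. (17)] [cite: KLS1988JSP, eq. (17)] -/
def xyFieldEnergy (L : ℕ) [NeZero L] (h : TorusSite d L → ℝ) : ℝ :=
  ∑ x : TorusSite d L, ∑ i : Fin d, (h x - h (x + Pi.single i 1)) ^ 2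

/-- The field-dependent XY Hamiltonian
`H(h) = H - Σ_{⟨xy⟩} (h_x - h_y)(S¹_x - S¹_y) + ½ Σ_{⟨xy⟩} (h_x - h_y)²`, `H = xyTorus d L n`;
`H(0) = H` (`xyFieldHamiltonian_zero`). [Kennedy–Lieb–Shastry, J. Stat. Phys. 53 (1988), eq. (17),
adapted to the XY model as indicated in Kennedy–Lieb–Shastry, PRL 61 (1988), after eq. (4)]
[cite: KLS1988JSP, eq. (17)] [cite: KLS1988PRL, after eq. (4)] -/
def xyFieldHamiltonian (L : ℕ) [NeZero L] (n : ℕ) (h : TorusSite d L → ℝ) :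
    Op (TorusSite d L) (n + 1) :=
  xyTorus d L n - xyGradField L n h + ((xyFieldEnergy L h / 2 : ℝ) : ℂ) • 1

/-- The cosine mode `C_q = Σ_x cos(q·x) S¹_x` of the first spin component at dual-torus
momentum `q` (`√|Λ|` times the Hermitian part of KLS's `Ŝ¹_{-q} = |Λ|^{-1/2} Σ_x e^{-iq·x} S¹_x`).
[Kennedy–Lieb–Shastry 1988, def. of `Ŝ_p` before eq. (2)] [cite: KLS1988PRL, before eq. (2)] -/
def xyCosMode (L : ℕ) [NeZero L] (n : ℕ) (q : TorusSite d L) : Op (TorusSite d L) (n + 1) :=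
  ∑ x : TorusSite d L, (Real.cos (torusPhase L q x) : ℂ) • siteSpin n x 0

/-- The sine mode `D_q = Σ_x sin(q·x) S¹_x` (`√|Λ|` times the anti-Hermitian part of `Ŝ¹_{-q}`,
divided by `-i`). [Kennedy–Lieb–Shastry 1988, def. of `Ŝ_p` before eq. (2)]
[cite: KLS1988PRL, before eq. (2)] -/
def xySinMode (L : ℕ) [NeZero L] (n : ℕ) (q : TorusSite d L) : Op (TorusSite d L) (n + 1) :=
  ∑ x : TorusSite d L, (Real.sin (torusPhase L q x) : ℂ) • siteSpin n x 0

/-- **(GD) Gaussian domination in the ground state** for the quantum XY model: for every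
dimension `d`, spin `n/2`, even side `L ≥ 4` and every real field `h` on the torus, the ground-state
energy of `H(h)` is at least that of `H = H(0)`: `E₀(H) ≤ E₀(H(h))`. This is eq. (18) of
Kennedy–Lieb–Shastry, J. Stat. Phys. 53 (1988) (stated and proved there for the Heisenberg
antiferromagnet, by reflection positivity in the real coefficient matrix of a real ground state,
eqs. (20)–(25), and a descent on the number of bonds with `h_x ≠ h_y`), in the XY setting of
Kennedy–Lieb–Shastry, PRL 61 (1988) (where `S¹` is real and `S²` purely imaginary, so that after
the rotation by `π` about the 1-axis on one sublattice of the bipartite even torus all bond terms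
are reflection positive); it is also the zero-temperature limit of the Gaussian domination bound
of Dyson–Lieb–Simon (1978). Even side is essential (bipartiteness and the pairs of reflection
planes); `L ≥ 4` excludes the degenerate side `2`.
[cite: KLS1988JSP, eq. (18)] [cite: KLS1988PRL, after eq. (4)] -/
def kls_xy_gaussianDomination_ground : Prop :=
  ∀ (d n L : ℕ) [NeZero L], Even L → 4 ≤ L → ∀ h : TorusSite d L → ℝ,
    (xyTorus d L n).groundEnergy ≤ (xyFieldHamiltonian L n h).groundEnergy

/-! ### API -/

section API

variable (L : ℕ) [NeZero L] (n : ℕ)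

/-- `V_0 = 0`. [folklore] -/
@[simp] theorem xyGradField_zero : xyGradField L n (0 : TorusSite d L → ℝ) = 0 := by
  simp [xyGradField]

/-- `Q(0) = 0`. [folklore] -/
@[simp] theorem xyFieldEnergy_zero : xyFieldEnergy L (0 : TorusSite d L → ℝ) = 0 := by
  simp [xyFieldEnergy]

/-- `H(0) = H`. [Kennedy–Lieb–Shastry, J. Stat. Phys. 53 (1988), after eq. (17)] [folklore] -/
@[simp] theorem xyFieldHamiltonian_zero :
    xyFieldHamiltonian L n (0 : TorusSite d L → ℝ) = xyTorus d L n := by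
  simp [xyFieldHamiltonian]

/-- `V_{t h} = t V_h`. [folklore] -/
theorem xyGradField_smul (t : ℝ) (h : TorusSite d L → ℝ) :
    xyGradField L n (t • h) = (t : ℂ) • xyGradField L n h := by
  simp only [xyGradField, Pi.smul_apply, smul_eq_mul, smul_sum, smul_smul, ← mul_sub,
    Complex.ofReal_mul]

/-- `Q(t h) = t² Q(h)`. [folklore] -/
theorem xyFieldEnergy_smul (t : ℝ) (h : TorusSite d L → ℝ) :
    xyFieldEnergy L (t • h) = t ^ 2 * xyFieldEnergy L h := by
  simp only [xyFieldEnergy, Pi.smul_apply, smul_eq_mul, mul_sum, ← mul_sub, mul_pow]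

/-- `Q(h) ≥ 0`. [folklore] -/
theorem xyFieldEnergy_nonneg (h : TorusSite d L → ℝ) : 0 ≤ xyFieldEnergy L h :=
  sum_nonneg fun _ _ => sum_nonneg fun _ _ => sq_nonneg _

/-- `V_h` is Hermitian (real coefficients, Hermitian spins). [folklore] -/
theorem xyGradField_isHermitian (h : TorusSite d L → ℝ) : (xyGradField L n h).IsHermitian := by
  unfold xyGradField
  refine (isSelfAdjoint_sum _ fun x _ => isSelfAdjoint_sum _ fun i _ => ?_).isHermitian
  refine Matrix.IsHermitian.isSelfAdjoint ?_
  rw [IsHermitian, conjTranspose_smul, Complex.star_def, Complex.conj_ofReal,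
    ((siteSpin_isHermitian n x 0).sub (siteSpin_isHermitian n _ 0)).eq]

/-- `C_q` is Hermitian. [folklore] -/
theorem xyCosMode_isHermitian (q : TorusSite d L) : (xyCosMode L n q).IsHermitian := by
  unfold xyCosMode
  refine (isSelfAdjoint_sum _ fun x _ => Matrix.IsHermitian.isSelfAdjoint ?_).isHermitian
  rw [IsHermitian, conjTranspose_smul, Complex.star_def, Complex.conj_ofReal,
    (siteSpin_isHermitian n x 0).eq]

/-- `D_q` is Hermitian. [folklore] -/
theorem xySinMode_isHermitian (q : TorusSite d L) : (xySinMode L n q).IsHermitian := by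
  unfold xySinMode
  refine (isSelfAdjoint_sum _ fun x _ => Matrix.IsHermitian.isSelfAdjoint ?_).isHermitian
  rw [IsHermitian, conjTranspose_smul, Complex.star_def, Complex.conj_ofReal,
    (siteSpin_isHermitian n x 0).eq]

/-- `H(t h) = H - t V_h + ½ t² Q(h)`: the form in which (GD) feeds the abstract ground-state
infrared bound. [folklore] -/
theorem xyFieldHamiltonian_smul (t : ℝ) (h : TorusSite d L → ℝ) :
    xyFieldHamiltonian L n (t • h) =
      xyTorus d L n + (t : ℂ) • (-xyGradField L n h) +
        ((t ^ 2 * xyFieldEnergy L h / 2 : ℝ) : ℂ) • 1 := by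
  rw [xyFieldHamiltonian, xyGradField_smul, xyFieldEnergy_smul, smul_neg, sub_eq_add_neg]

end API

end Literature.MathematicalPhysics.QuantumLattice
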